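import Summits.Ventures.WeilGRH.FlatSumUnconditional
import HarnessLib

/-!
# rh-explicit (venture WeilGRH): THE PLAIN PRIME SUM OF A WINDOW IS AT MOST `c·(2eᵃ − 1)` WHENEVER `ψ(t) ≤ c·t` ON THE
  WINDOW — `Σ_{log n<2a} Λ(n)n^{-1/2} ≤ 2.2844·eᵃ − 1.1422` unconditionally

Cell `rh-explicit`, WEIL TRACK (structure seat weil-3, gen13).  RH-free real analysis; companion of
`FlatSumChebyshev` / `FlatSumUnconditional` (the FLAT prime sum `S(a)`).  The Beurling–Selberg window law
(`WeilSelbergWindowLaw`) has a second arithmetic constant, the PLAIN prime sum of the window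

  `T(a) = Σ_{log n < 2a} Λ(n) n^{-1/2}`

(the phase-blind bound `(2/π)T(a)` of the Gram cross term).  By Abel summation with the weight `t^{-1/2}`:

* `primeSum_le_sum_Icc`: `T(a) ≤ Σ_{k ≤ ⌊e^{2a}⌋} Λ(k)/√k` (the strict window inequality only drops a non-negative term);
* **`primeSum_le_of_psi_le_on`**: if `ψ(t) ≤ c·t` for `0 ≤ t ≤ e^{2a}` then `T(a) ≤ c·(2eᵃ − 1)`
  (`Σ_{k≤x} Λ(k)k^{-1/2} = ψ(x)x^{-1/2} + ½∫₁^x ψ(t)t^{-3/2}dt ≤ c√x + c(√x − 1)`);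
* **`primeSum_le_unconditional`**: `T(a) ≤ 1.1422·(2eᵃ − 1)` for every `a > 0` (the tree's standard-axiom Chebyshev bound
  `FlatSumUnconditional.psi_le_mul_unconditional`); `primeSum_le_of_exp_le`: `1.04·(2eᵃ − 1)` when `e^{2a} ≤ 10⁴`.

No definitions, no named facts; RH-free.
-/

set_option autoImplicit false

noncomputable section

open MeasureTheory Finset
open scoped Real Topology Chebyshev ArithmeticFunction.vonMangoldt

namespace Summit.Ventures.WeilGRH

open Literature.NumberTheory.LFunctions

/-! ## The window sum against the sum over `k ≤ ⌊e^{2a}⌋` -/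

/-- **`T(a) ≤ Σ_{k ≤ ⌊e^{2a}⌋} Λ(k)/√k`** (the window `log n < 2a` is contained in `n ≤ e^{2a}`, all terms `≥ 0`). -/
theorem primeSum_le_sum_Icc (a : ℝ) :
    ∑ n ∈ weilPrimeIndex a, (Λ n : ℝ) / Real.sqrt n ≤
      ∑ k ∈ Icc 0 ⌊Real.exp (2 * a)⌋₊, 1 / Real.sqrt k * (Λ k : ℝ) := by
  unfold weilPrimeIndex
  rw [Nat.range_succ_eq_Icc_zero]
  calc ∑ n ∈ (Icc 0 ⌊Real.exp (2 * a)⌋₊).filter (fun n : ℕ ↦ Real.log n < 2 * a), (Λ n : ℝ) / Real.sqrt n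
      ≤ ∑ n ∈ Icc 0 ⌊Real.exp (2 * a)⌋₊, (Λ n : ℝ) / Real.sqrt n :=
        Finset.sum_le_sum_of_subset_of_nonneg (Finset.filter_subset _ _) fun n _ _ ↦
          div_nonneg ArithmeticFunction.vonMangoldt_nonneg (Real.sqrt_nonneg _)
    _ = ∑ k ∈ Icc 0 ⌊Real.exp (2 * a)⌋₊, 1 / Real.sqrt k * (Λ k : ℝ) :=
        Finset.sum_congr rfl fun k _ ↦ by ring

/-! ## Abel summation with the weight `t^{-1/2}` -/

/-- `d/dt[1/√t] = −1/(2t√t)` for `t > 0`. -/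
theorem hasDerivAt_inv_sqrt {t : ℝ} (ht : 0 < t) :
    HasDerivAt (fun s : ℝ ↦ 1 / Real.sqrt s) (-(1 / (2 * t * Real.sqrt t))) t := by
  have hs : 0 < Real.sqrt t := Real.sqrt_pos.2 ht
  have h2 : HasDerivAt (fun s : ℝ ↦ Real.sqrt s) (1 / (2 * Real.sqrt t)) t := Real.hasDerivAt_sqrt ht.ne'
  have h := h2.inv hs.ne'
  have e : (fun s : ℝ ↦ 1 / Real.sqrt s) = fun s ↦ (Real.sqrt s)⁻¹ := by funext s; rw [one_div]
  rw [e]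
  refine h.congr_deriv ?_
  have hss : Real.sqrt t ^ 2 = t := Real.sq_sqrt ht.le
  field_simp
  rw [hss]

/-- **THE PLAIN PRIME SUM AGAINST A CHEBYSHEV BOUND ON THE WINDOW**: if `ψ(t) ≤ c·t` for `0 ≤ t ≤ e^{2a}`, then

  `Σ_{log n < 2a} Λ(n) n^{-1/2} ≤ c·(2eᵃ − 1)`. -/
theorem primeSum_le_of_psi_le_on {c a : ℝ} (ha : 0 < a)
    (hψ : ∀ t : ℝ, 0 ≤ t → t ≤ Real.exp (2 * a) → ψ t ≤ c * t) :
    ∑ n ∈ weilPrimeIndex a, (Λ n : ℝ) / Real.sqrt n ≤ c * (2 * Real.exp a - 1) := by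
  refine (primeSum_le_sum_Icc a).trans ?_
  set x : ℝ := Real.exp (2 * a) with hx
  have hx1 : 1 ≤ x := by rw [hx]; exact Real.one_le_exp (by linarith)
  have hx0 : 0 < x := by linarith
  have hsqrtx : Real.sqrt x = Real.exp a := by
    rw [hx, show 2 * a = a + a by ring, Real.exp_add, Real.sqrt_mul_self (Real.exp_pos a).le]
  have hc : 0 ≤ c := by
    have h1 := hψ 1 zero_le_one hx1
    have h0 : 0 ≤ ψ 1 := Chebyshev.psi_nonneg 1
    linarith
  -- the weight and its derivative
  set w : ℝ → ℝ := fun s ↦ 1 / Real.sqrt s with hw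
  set w' : ℝ → ℝ := fun t ↦ -(1 / (2 * t * Real.sqrt t)) with hw'
  have hderiv : ∀ t : ℝ, 0 < t → HasDerivAt w (w' t) t := fun t ht ↦ hasDerivAt_inv_sqrt ht
  have hdiff : ∀ t ∈ Set.Icc 1 x, DifferentiableAt ℝ w t :=
    fun t ht ↦ (hderiv t (by linarith [ht.1])).differentiableAt
  have hderiv_eq : ∀ t : ℝ, 0 < t → deriv w t = w' t := fun t ht ↦ (hderiv t ht).deriv
  have hcontAt : ∀ t : ℝ, 0 < t → ContinuousAt w' t ∧ ContinuousAt (fun s : ℝ ↦ 1 / (2 * Real.sqrt s)) t := by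
    intro t ht
    have h2 : ContinuousAt Real.sqrt t := Real.continuous_sqrt.continuousAt
    have hs0 : Real.sqrt t ≠ 0 := (Real.sqrt_pos.2 ht).ne'
    refine ⟨(continuousAt_const.div ((continuousAt_const.mul continuousAt_id).mul h2) ?_).neg,
      continuousAt_const.div (continuousAt_const.mul h2) (mul_ne_zero two_ne_zero hs0)⟩
    exact mul_ne_zero (mul_ne_zero two_ne_zero ht.ne') hs0
  have hcont : ContinuousOn w' (Set.Icc 1 x) :=
    fun t ht ↦ ((hcontAt t (by linarith [ht.1])).1).continuousWithinAt
  have hint' : IntegrableOn w' (Set.Icc 1 x) := hcont.integrableOn_Icc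
  have hint : IntegrableOn (deriv w) (Set.Icc 1 x) :=
    hint'.congr_fun (fun t ht ↦ (hderiv_eq t (by linarith [ht.1])).symm) measurableSet_Icc
  -- Abel summation
  have habel := sum_mul_eq_sub_integral_mul₀ (fun k ↦ (Λ k : ℝ)) (by simp) x hdiff hint
  have hS : (∑ k ∈ Icc 0 ⌊x⌋₊, 1 / Real.sqrt k * (Λ k : ℝ)) = ∑ k ∈ Icc 0 ⌊x⌋₊, w k * (Λ k : ℝ) := rfl
  rw [hS, habel]
  -- the boundary term `w(x)ψ(x) ≤ c√x`
  have hψsum : ∑ k ∈ Icc 0 ⌊x⌋₊, (Λ k : ℝ) = ψ x := (Chebyshev.psi_eq_sum_Icc x).symm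
  have hbd : w x * ∑ k ∈ Icc 0 ⌊x⌋₊, (Λ k : ℝ) ≤ c * Real.sqrt x := by
    rw [hψsum, hw]
    have hsx : 0 < Real.sqrt x := Real.sqrt_pos.2 hx0
    have hψx := hψ x hx0.le le_rfl
    have hxx : Real.sqrt x * Real.sqrt x = x := Real.mul_self_sqrt hx0.le
    show 1 / Real.sqrt x * ψ x ≤ c * Real.sqrt x
    rw [div_mul_eq_mul_div, one_mul, div_le_iff₀ hsx]
    nlinarith
  -- the integral term: `−∫ w'ψ ≤ c∫ 1/(2√t) = c(√x − 1)`
  have hI : ∫ t in Set.Ioc 1 x, deriv w t * ∑ k ∈ Icc 0 ⌊t⌋₊, (Λ k : ℝ) = ∫ t in Set.Ioc 1 x, w' t * ψ t :=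
    setIntegral_congr_fun measurableSet_Ioc fun t ht ↦ by
      rw [hderiv_eq t (by linarith [ht.1]), Chebyshev.psi_eq_sum_Icc]
  rw [hI]
  have hIψ : IntegrableOn (fun t : ℝ ↦ w' t * ψ t) (Set.Ioc 1 x) := by
    have h := (integrableOn_mul_sum_Icc (fun k ↦ (Λ k : ℝ)) (m := 0) zero_le_one hint').mono_set
      Set.Ioc_subset_Icc_self
    exact h.congr_fun (fun t _ ↦ by rw [Chebyshev.psi_eq_sum_Icc]) measurableSet_Ioc
  have hGcont : ContinuousOn (fun s : ℝ ↦ 1 / (2 * Real.sqrt s)) (Set.Icc 1 x) :=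
    fun t ht ↦ ((hcontAt t (by linarith [ht.1])).2).continuousWithinAt
  have hIc : IntegrableOn (fun t : ℝ ↦ c * (1 / (2 * Real.sqrt t))) (Set.Ioc 1 x) :=
    (hGcont.integrableOn_Icc.mono_set Set.Ioc_subset_Icc_self).const_mul c
  have hpt : ∀ t ∈ Set.Ioc 1 x, -(w' t * ψ t) ≤ c * (1 / (2 * Real.sqrt t)) := by
    intro t ht
    have ht0 : 0 < t := by linarith [ht.1]
    have hs : 0 < Real.sqrt t := Real.sqrt_pos.2 ht0
    have hψt := hψ t ht0.le ht.2
    have hψ0 := Chebyshev.psi_nonneg t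
    have hK : 0 ≤ 1 / (2 * t * Real.sqrt t) := by positivity
    have e1 : -(w' t * ψ t) = 1 / (2 * t * Real.sqrt t) * ψ t := by rw [hw']; ring
    have e2 : c * (1 / (2 * Real.sqrt t)) = 1 / (2 * t * Real.sqrt t) * (c * t) := by field_simp
    rw [e1, e2]
    exact mul_le_mul_of_nonneg_left hψt hK
  have hmono : ∫ t in Set.Ioc 1 x, -(w' t * ψ t) ≤ ∫ t in Set.Ioc 1 x, c * (1 / (2 * Real.sqrt t)) :=
    setIntegral_mono_on hIψ.neg hIc measurableSet_Ioc hpt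
  have hGcont' : ContinuousOn (fun s : ℝ ↦ 1 / (2 * Real.sqrt s)) (Set.uIcc 1 x) := by
    rwa [Set.uIcc_of_le hx1]
  have hFTC : ∫ t in Set.Ioc 1 x, 1 / (2 * Real.sqrt t) = Real.sqrt x - Real.sqrt 1 := by
    rw [← intervalIntegral.integral_of_le hx1]
    refine intervalIntegral.integral_eq_sub_of_hasDerivAt (fun t ht ↦ Real.hasDerivAt_sqrt ?_) hGcont'.intervalIntegrable
    rw [Set.uIcc_of_le hx1] at ht
    have : 0 < t := by linarith [ht.1]
    exact this.ne'
  have hIval : ∫ t in Set.Ioc 1 x, c * (1 / (2 * Real.sqrt t)) = c * (Real.sqrt x - 1) := by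
    rw [integral_const_mul, hFTC, Real.sqrt_one]
  have hneg : -(∫ t in Set.Ioc 1 x, w' t * ψ t) ≤ c * (Real.sqrt x - 1) := by
    rw [← integral_neg, ← hIval]; exact hmono
  rw [hsqrtx] at hbd hneg
  linarith

/-- **`T(a) ≤ 1.1422·(2eᵃ − 1)`** for every `a > 0`, with STANDARD axioms (`psi_le_mul_unconditional`). -/
theorem primeSum_le_unconditional {a : ℝ} (ha : 0 < a) :
    ∑ n ∈ weilPrimeIndex a, (Λ n : ℝ) / Real.sqrt n ≤ 1.1422 * (2 * Real.exp a - 1) :=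
  primeSum_le_of_psi_le_on ha fun _ ht _ ↦ psi_le_mul_unconditional ht

/-- **`T(a) ≤ 1.04·(2eᵃ − 1)` when `e^{2a} ≤ 10⁴`** (only the kernel computation `ψ(t) ≤ 1.04t`, `t ≤ 10⁴`, enters). -/
theorem primeSum_le_of_exp_le {a : ℝ} (ha : 0 < a) (h : Real.exp (2 * a) ≤ 10000) :
    ∑ n ∈ weilPrimeIndex a, (Λ n : ℝ) / Real.sqrt n ≤ 1.04 * (2 * Real.exp a - 1) :=
  primeSum_le_of_psi_le_on ha fun _ ht htx ↦ SchoenfeldBound.psi_le_of_le_ten_thousand ht (htx.trans h)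

end Summit.Ventures.WeilGRH

end
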